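import Summits.BirchSwinnertonDyer.BirchSwinnertonDyer.Theorems.SignedBaseChangeAnticyclotomicEisensteinDivisibilityAdmdefChebSplitFamily
import Summits.BirchSwinnertonDyer.BirchSwinnertonDyer.Theorems.SignedBaseChangeAnticyclotomicEisensteinDivisibilityAdmdefChebSplitTarget
import Summits.BirchSwinnertonDyer.BirchSwinnertonDyer.Theorems.AdditiveKolyvaginRoadLevelDefs
import HarnessLib

/-!
# Line `admdef`, cell β (`p` split in `K`): the FAMILY Čebotarev at one admissible prime, target discharged
# (crux `AnticyclotomicEisensteinDivisibility`, stmt-BirchSwinnertonDyer-20727; LEAD seat bsd-line-sbc-p1 gen 27,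
# `--supports stmt-BirchSwinnertonDyer-20727`; rigidity road item (M3), wrapper of `…AdmdefChebSplitFamily`)

`exists_admissible_forall_torsionLocMap_ne_zero_of_eigen` — on cell β's frame (`p ≥ 5`, `ρ̄_{E,p}` onto, `K` imaginary quadratic, Heegner
hypothesis for `N_E`, `p` split in `K`), for a complex conjugation `c ≠ 1`, a sign index `μ`, and a family `xs : Fin r → H¹(K, E[p])`
(`AdditiveKoly.Vp`) of `sgnP μ`-eigenclasses of `c_*` which is linearly independent over `𝔽_p`: there is a Bertolini–Darmon `1`-admissible
prime `q ∉ B₀` and a place `v ∋ q` of `K` with `loc_v (xs i) ≠ 0` for EVERY `i`.  (`…AdmdefChebSplitFamily.exists_admissible_forall_loc_ne_zero_of_target`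
fed with `…AdmdefChebSplitTarget.exists_admissible_target_of_split`; family form of `…AdmdefRootZero.exists_admissible_torsionLocMap_ne_zero_of_eigen`.)
This is the input «two independent classes seen at ONE admissible prime» of Howard's rigidity induction ([Howard2006] Thm. 3.2.3) in the
`SelQP` walk currency of the AKR road.

HONEST FRAMING: theorems only; nothing about the anchors, the crux or BSD is asserted; OFF the v23 composition path.

References: [cite: Howard2006, §3.3, Thm. 3.2.3] [cite: BertoliniDarmon2005, Thm. 3.2] [cite: WZhang2014, Lemma 7.3] [cite: GrossLMS1991, Prop. 9.3, 9.6].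
-/

-- D-0017: single-problem summit, the namespace repeats the problem name by design.
set_option linter.dupNamespace false
set_option autoImplicit false

noncomputable section

open scoped Classical NumberField

namespace Summit.BirchSwinnertonDyer.BirchSwinnertonDyer.Theorems.SignedBaseChangeAcDivAdmdefChebSplitFamily

open WeierstrassCurve NumberField IsDedekindDomain Field Module
  Literature.NumberTheory.EllipticCurves Literature.NumberTheory.GaloisRepresentations
  Literature.NumberTheory.EllipticCurves.BertoliniDarmon2005
  Summit.BirchSwinnertonDyer.BirchSwinnertonDyer.Theorems Summit.BirchSwinnertonDyer.BirchSwinnertonDyer.Theorems.AdditiveKoly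
  Summit.BirchSwinnertonDyer.Rank1Residual.X11b.Three.Koly.Method2

variable (W : WeierstrassCurve ℚ) (K : Type) [Field K] [NumberField K] (p : ℕ) [W.IsElliptic] [W.IsGloballyMinimal] [Fact p.Prime]

/-- **Čebotarev with the sign for an independent family of EIGENCLASSES on cell β, target discharged.**  Frame: `p ≥ 5`, `ρ̄_{E,p}` onto,
`K` imaginary quadratic, Heegner hypothesis for `N_E`, `p` split in `K`; `c ≠ 1` the complex conjugation of `K`, `μ` a sign index,
`xs : Fin r → H¹(K, E[p])` a family of `sgnP μ`-eigenclasses of `c_*`, linearly independent over `𝔽_p` (`∑ aᵢ xᵢ = 0 ⟹ p ∣ aᵢ`), `B₀ ⊂ ℕ`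
finite.  Then some Bertolini–Darmon `1`-admissible `q ∉ B₀` and place `v ∋ q` of `K` have `loc_v (xs i) ≠ 0` in `H¹(K_v, E[p])` for every `i`.
[cite: Howard2006, §3.3, Thm. 3.2.3] [cite: BertoliniDarmon2005, Thm. 3.2] [cite: WZhang2014, Lemma 7.3] -/
theorem exists_admissible_forall_torsionLocMap_ne_zero_of_eigen (h5 : 5 ≤ p) (hsurj : W.HasSurjectiveModNGaloisRep p)
    (hK : IsImaginaryQuadratic K) (hH : SatisfiesHeegnerHypothesis (W.conductorNorm ℤ) K)
    (hsp : ((Ideal.span {(p : ℤ)}).primesOver (𝓞 K)).ncard = 2) {c : K ≃ₐ[ℚ] K} (hc1 : c ≠ 1) (μ : Bool)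
    {r : ℕ} (xs : Fin r → Vp W K p) (hxν : ∀ i, conjAct W c ((p ^ 1 : ℕ) : ℤ) (xs i) = sgnP μ • xs i)
    (hind : ∀ a : Fin r → ℤ, ∑ i, a i • xs i = 0 → ∀ i, (p : ℤ) ∣ a i) (B₀ : Finset ℕ) :
    ∃ q : ℕ, q ∉ B₀ ∧ IsAdmissiblePrime (W.conductorNorm ℤ) K (fun ℓ ↦ W.frobeniusTrace ℓ) p 1 q ∧
      ∃ v : HeightOneSpectrum (𝓞 K), ((q : ℕ) : 𝓞 K) ∈ v.asIdeal ∧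
        ∀ i, (W.baseChange K).torsionLocMap (v.adicCompletion K) ((p ^ 1 : ℕ) : ℤ) (xs i) ≠ 0 := by
  -- adapted from Theorems/…AdmdefRootZero.lean `exists_admissible_torsionLocMap_ne_zero_of_eigen` (one class ↦ a family)
  have hp : p.Prime := Fact.out
  haveI : Fact (Nat.Prime (p ^ 1)) := ⟨by rw [pow_one]; exact hp⟩
  have h5' : 5 ≤ p ^ 1 := by rw [pow_one]; exact h5
  have hsp' : ((Ideal.span {((p ^ 1 : ℕ) : ℤ)}).primesOver (𝓞 K)).ncard = 2 := by rw [pow_one]; exact hsp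
  have hsurj' : W.HasSurjectiveModNGaloisRep ((p ^ 1 : ℕ) : ℤ) := by rw [Nat.pow_one]; exact hsurj
  have hν : sgnP μ = 1 ∨ sgnP μ = -1 := by cases μ <;> simp [sgnP]
  have hind' : ∀ a : Fin r → ℤ, ∑ i, a i • xs i = 0 → ∀ i, ((p ^ 1 : ℕ) : ℤ) ∣ a i := fun a ha i ↦ by
    rw [Nat.pow_one]; exact hind a ha i
  obtain ⟨q, hqB, hadm, v, hqv, hloc⟩ :=
    exists_admissible_forall_loc_ne_zero_of_target W K (p := p ^ 1) h5' hK hsurj' hc1 hν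
      (fun ht hinv ↦ SignedBaseChangeAcDivAdmdefChebSplit.exists_admissible_target_of_split W K (p := p ^ 1) h5' hK hsurj' hsp'
        hH ht hinv hν)
      hind' hxν B₀
  rw [Nat.pow_one] at hadm
  exact ⟨q, hqB, hadm, v, hqv, fun i h0 ↦ hloc i h0⟩

end Summit.BirchSwinnertonDyer.BirchSwinnertonDyer.Theorems.SignedBaseChangeAcDivAdmdefChebSplitFamily

end
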